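import Summits.Ventures.PercRepro.SeriesParallelC005

/-!
# Relabelling a marked multigraph: partition probabilities and C-005 are isomorphism invariants

`G.IsIso G' φ ψ` says that the bijections `φ` on vertices and `ψ` on edges carry `G` onto `G'`:
every edge `e` of `G` with endpoints `x, y` is the edge `ψ e` of `G'` with endpoints `φ x, φ y`
(in either order). Open adjacency, connectivity and the partition events transport along such an
isomorphism (`openAdj_iff`, `conn_iff`, `mem_partitionEvent_iff`), the weight of a configuration
transports along `ψ` (`weight_comp`), so every partition probability of `G'` at the weights `p'`
with marks `φ ∘ m` equals the one of `G` at the weights `p' ∘ ψ` with marks `m`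
(`prob_partitionEvent`), and **C-005 is an isomorphism invariant** (`c005At_iff`).
This is the tool that turns a census of graphs up to isomorphism into a theorem about every
labelled graph.
-/

namespace PercRepro

namespace MultiGraph

open Finset

variable {V E V' E' : Type}

/-- `G.IsIso G' φ ψ`: the bijections `φ : V ≃ V'` and `ψ : E ≃ E'` carry `G` onto `G'` — the
edge `ψ e` of `G'` joins `φ (G.fst e)` and `φ (G.snd e)` (in either order). -/
def IsIso (G : MultiGraph V E) (G' : MultiGraph V' E') (φ : V ≃ V') (ψ : E ≃ E') : Prop :=
  ∀ e, (G'.fst (ψ e) = φ (G.fst e) ∧ G'.snd (ψ e) = φ (G.snd e)) ∨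
    (G'.fst (ψ e) = φ (G.snd e) ∧ G'.snd (ψ e) = φ (G.fst e))

variable {G : MultiGraph V E} {G' : MultiGraph V' E'} {φ : V ≃ V'} {ψ : E ≃ E'}

/-- Open adjacency transports along an isomorphism: `φ a` and `φ b` are joined by an open edge
of the relabelled configuration `ω ∘ ψ.symm` iff `a` and `b` are joined by an open edge of `ω`. -/
theorem IsIso.openAdj_iff (h : G.IsIso G' φ ψ) (ω : Config E) (a b : V) :
    G'.OpenAdj (ω ∘ ψ.symm) (φ a) (φ b) ↔ G.OpenAdj ω a b := by
  constructor
  · rintro ⟨e', he', hend⟩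
    refine ⟨ψ.symm e', he', ?_⟩
    have he := h (ψ.symm e')
    rw [Equiv.apply_symm_apply] at he
    rcases he with ⟨h1, h2⟩ | ⟨h1, h2⟩ <;> rcases hend with ⟨h3, h4⟩ | ⟨h3, h4⟩
    · exact Or.inl ⟨φ.injective (h1.symm.trans h3), φ.injective (h2.symm.trans h4)⟩
    · exact Or.inr ⟨φ.injective (h1.symm.trans h3), φ.injective (h2.symm.trans h4)⟩
    · exact Or.inr ⟨φ.injective (h2.symm.trans h4), φ.injective (h1.symm.trans h3)⟩
    · exact Or.inl ⟨φ.injective (h2.symm.trans h4), φ.injective (h1.symm.trans h3)⟩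
  · rintro ⟨e, he, hend⟩
    refine ⟨ψ e, by simpa using he, ?_⟩
    rcases h e with ⟨h1, h2⟩ | ⟨h1, h2⟩ <;> rcases hend with ⟨h3, h4⟩ | ⟨h3, h4⟩
    · exact Or.inl ⟨by rw [h1, h3], by rw [h2, h4]⟩
    · exact Or.inr ⟨by rw [h1, h3], by rw [h2, h4]⟩
    · exact Or.inr ⟨by rw [h1, h4], by rw [h2, h3]⟩
    · exact Or.inl ⟨by rw [h1, h4], by rw [h2, h3]⟩

/-- Connectivity transports along an isomorphism. -/
theorem IsIso.conn_iff (h : G.IsIso G' φ ψ) (ω : Config E) (u v : V) :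
    G'.Conn (ω ∘ ψ.symm) (φ u) (φ v) ↔ G.Conn ω u v := by
  constructor
  · intro huv
    have key : Relation.ReflTransGen (G.OpenAdj ω) (φ.symm (φ u)) (φ.symm (φ v)) :=
      Relation.ReflTransGen.lift (r := G'.OpenAdj (ω ∘ ψ.symm)) φ.symm
        (fun a b hab => by
          have := (h.openAdj_iff ω (φ.symm a) (φ.symm b)).1
          simp only [Equiv.apply_symm_apply] at this
          exact this hab) _ _ huv
    simpa [Conn] using key
  · intro huv
    exact Relation.ReflTransGen.lift (r := G.OpenAdj ω) φ
      (fun a b hab => (h.openAdj_iff ω a b).2 hab) _ _ huv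

/-- Partition events transport along an isomorphism (marks `m` become `φ ∘ m`). -/
theorem IsIso.mem_partitionEvent_iff (h : G.IsIso G' φ ψ) {k : ℕ} (m : Fin k → V)
    (rgs : Fin k → ℕ) (ω : Config E) :
    (ω ∘ ψ.symm) ∈ G'.partitionEvent (φ ∘ m) rgs ↔ ω ∈ G.partitionEvent m rgs := by
  simp only [partitionEvent, Set.mem_setOf_eq, Function.comp_apply]
  constructor
  · intro H i j
    rw [← H i j, h.conn_iff]
  · intro H i j
    rw [h.conn_iff, H i j]

/-- The weight of a relabelled configuration at the weights `p'` is the weight of the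
configuration at the weights `p' ∘ ψ`. -/
theorem weight_comp_symm [Fintype E] [Fintype E'] (ψ : E ≃ E') (p' : E' → ℝ) (ω : Config E) :
    weight p' (ω ∘ ψ.symm) = weight (p' ∘ ψ) ω := by
  unfold weight
  rw [← Equiv.prod_comp ψ]
  simp only [Function.comp_apply, Equiv.symm_apply_apply]

/-- **Partition probabilities are isomorphism invariants**: the probability under `G'` at the
weights `p'` of the partition row `rgs` of the marks `φ ∘ m` is the probability under `G` at the
weights `p' ∘ ψ` of the row `rgs` of the marks `m`. -/
theorem IsIso.prob_partitionEvent (h : G.IsIso G' φ ψ) [Fintype E] [DecidableEq E] [Fintype E']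
    [DecidableEq E'] (p' : E' → ℝ) {k : ℕ} (m : Fin k → V) (rgs : Fin k → ℕ) :
    prob p' (G'.partitionEvent (φ ∘ m) rgs) = prob (p' ∘ ψ) (G.partitionEvent m rgs) := by
  unfold prob
  rw [← Equiv.sum_comp (Equiv.arrowCongr ψ (Equiv.refl Bool))]
  refine Fintype.sum_congr _ _ fun ω => ?_
  have hω : (Equiv.arrowCongr ψ (Equiv.refl Bool)) ω = ω ∘ ψ.symm := by
    funext e'
    simp [Equiv.arrowCongr_apply]
  rw [hω]
  by_cases hmem : ω ∈ G.partitionEvent m rgs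
  · rw [Set.indicator_of_mem hmem, Set.indicator_of_mem ((h.mem_partitionEvent_iff m rgs ω).2 hmem),
      weight_comp_symm]
  · rw [Set.indicator_of_notMem hmem,
      Set.indicator_of_notMem (fun H => hmem ((h.mem_partitionEvent_iff m rgs ω).1 H))]

/-- Composing a probability vector with a bijection keeps it a probability vector. -/
theorem IsProb.comp_equiv {p' : E' → ℝ} (hp : IsProb p') (ψ : E ≃ E') : IsProb (p' ∘ ψ) :=
  fun e => hp (ψ e)

/-- The marks `![φ a, φ b, φ c, φ d]` are `φ ∘ ![a, b, c, d]`. -/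
theorem vecCons_comp_four (φ : V → V') (a b c d : V) :
    (![φ a, φ b, φ c, φ d] : Fin 4 → V') = φ ∘ ![a, b, c, d] := by
  funext i
  fin_cases i <;> rfl

/-- **C-005 is an isomorphism invariant**: `G'` at the weights `p'` with marks `φ a, φ b, φ c, φ d`
satisfies C-005 iff `G` at the weights `p' ∘ ψ` with marks `a, b, c, d` does. -/
theorem IsIso.c005At_iff (h : G.IsIso G' φ ψ) [Fintype E] [DecidableEq E] [Fintype E']
    [DecidableEq E'] (p' : E' → ℝ) (a b c d : V) :
    G'.C005At p' (φ a) (φ b) (φ c) (φ d) ↔ G.C005At (p' ∘ ψ) a b c d := by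
  unfold C005At
  rw [vecCons_comp_four, h.prob_partitionEvent, h.prob_partitionEvent, h.prob_partitionEvent,
    h.prob_partitionEvent, h.prob_partitionEvent]

/-- C-005 transports along an isomorphism (the weights of `G'` are `p ∘ ψ.symm`). -/
theorem IsIso.c005At (h : G.IsIso G' φ ψ) [Fintype E] [DecidableEq E] [Fintype E']
    [DecidableEq E'] (p : E → ℝ) (a b c d : V) (hG : G.C005At p a b c d) :
    G'.C005At (p ∘ ψ.symm) (φ a) (φ b) (φ c) (φ d) := by
  rw [h.c005At_iff]
  have : (p ∘ ψ.symm) ∘ ψ = p := by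
    funext e
    simp
  rw [this]
  exact hG

/-- C-005 transports back along an isomorphism: from `G'` at the weights `p'` to `G` at
`p' ∘ ψ`. -/
theorem IsIso.c005At_of (h : G.IsIso G' φ ψ) [Fintype E] [DecidableEq E] [Fintype E']
    [DecidableEq E'] (p' : E' → ℝ) (a b c d : V)
    (hG' : G'.C005At p' (φ a) (φ b) (φ c) (φ d)) : G.C005At (p' ∘ ψ) a b c d :=
  (h.c005At_iff p' a b c d).1 hG'

/-- The isomorphism relation is symmetric: the inverse bijections carry `G'` back onto `G`. -/
theorem IsIso.symm (h : G.IsIso G' φ ψ) : G'.IsIso G φ.symm ψ.symm := by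
  intro e'
  have he := h (ψ.symm e')
  rw [Equiv.apply_symm_apply] at he
  rcases he with ⟨h1, h2⟩ | ⟨h1, h2⟩
  · exact Or.inl ⟨by rw [h1, Equiv.symm_apply_apply], by rw [h2, Equiv.symm_apply_apply]⟩
  · exact Or.inr ⟨by rw [h2, Equiv.symm_apply_apply], by rw [h1, Equiv.symm_apply_apply]⟩

end MultiGraph

end PercRepro
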